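import Summits.ValiantsHypothesis.ValiantsHypothesis.Theorems.NewtonUnitEquationsTwoProductsRankOneSchemaLawLift
import HarnessLib

/-!
# Route NewtonUnitEquations — crux `TwoProducts` (stmt-ValiantsHypothesis-5906), line `relation_ladder`, rung R9 (the RANK-ONE
# SCHEMA law: ONE datum `(ρ⁺, ρ⁻)` of ANY shape) by the TRANSPORTATION LIFT — part 2/8 — reduced exponents, the relation part `Lrel`, fibres `Lof` with the consistency guard `Adm`, degrees, the multinomial regrouping, fibre sums (T3)

THE RANK-ONE SCHEMA LAW (R9): if ALL additive coincidences of the letter family of `(u, v)` are multiples of ONE datum `(ρ⁺, ρ⁻)` —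
ANY datum `ρ⁺, ρ⁻ : Expo →₀ ℕ`, no side condition — then GLOBALLY `#visible ≤ 2^{c m}(#T + 2)^c` (`c = 1416`).  This is the rank-one SCHEMA
quantified over the datum asked for by the Negative lane (val-neg-1 g4, evidence #48 on stmt-5906, item (a)); it SUBSUMES the rungs R3♯
(`permTypeLaw_proof`), R6, R6b, R6c, R7a, R7b, R7c, R8 (each of their hypotheses exhibits a datum).  Engine = the TRANSPORTATION LIFT of
val-idea-8 g3's memo `Cruxes/TwoProducts/Lines/relation_ladder_R7_engine.md` §1 / `…R8_engine.md` §5 made uniform: for the disjoint balanced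
relation `Σ_{i ∈ P} p_i • α_i = Σ_{j ∈ N} q_j • β_j` the atoms are `Z_{ij}`, `(i, j) ∈ P × N` (upstairs index type `σ ⊕ σ × σ`: free letters on
the left, atoms on the right), `Y_{α_i} ↦ ∏_j Z_{ij}^{q_j}`, `Y_{β_j} ↦ ∏_i Z_{ij}^{p_i}`; the planar push-forward is the PRODUCT PLAN
`E'(Z_{ij})_c = (α_i)_c (β_j)_c T'_{1-c}` over the `D = T'_0 T'_1`-dilated plane (`T_c = Σ_i p_i (α_i)_c`, `T' = max(T, 1)`), the upstairs
weights are the PRODUCT PLAN `θ_{ij} = r_i r_j / R` of the letter weights (pointwise positive, NOT a pull-back; balanced because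
`Σ p_i r_i = Σ q_j r_j`); the fibre over an atom monomial is parametrised by `κ = #α_{a₀}` with a CONSISTENCY guard over all `|P|·|N|` atom
equations; SLICING by the atom exponents (≤ `2^{3m}` slices through the simplex `R8.card_W_le`); the coefficient theorem
`Pfac · C(R + B_κ − 1, B_κ) · κ_κ` and the shift rank `2m(ΣA + 1)² + 1` are shape-independent (the free letters enter only through the binomial);
`ShiftRank.pencilCount` BY NAME.  Reductions: common part of the datum (`DatumExcess.rankOne_reduce`), large / absent coefficients
(`R7a.permType_of_rankOne_largeCoeff/absent`), wide sides (`permType_of_rankOne_wideSide`), and a non-permutation coincidence balances the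
datum and makes both sides non-empty (`sides_of_shift`, over val-neg-1 g4's `OneSidedMembership.weight_*` / `DatumExcess.*`).

AUTHORSHIP / LANE NOTE (val-lit-p3 g16, prover seat, KEEP lineage, helper mode `--supports stmt-ValiantsHypothesis-5906 --as helper`;
CLAIM #1 on the val-lit bus 14:45Z 2026-08-28, ★ 15:03Z; no val-idea-8 seat alive at the time — the typed target is staged for the line
owner as `HOME/lmr/staged/p3g16-R9/sketch_R9.lean`, and the closing theorem is stated by its LITERAL BODY so that a later skeleton can wire
`stub := R9.rankOneSchemaLaw_proof` by name).  Mathematics and Lean text of this module: this seat, generalising its predecessor's R8 port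
(`…RankOneOneSidedLaw*`, val-lit-p3 g15) decl by decl.  Reused BY NAME: `R6b.HSD` (+ closure lemmas), `R7b.dilE`/`piT_dilE`/`piE_dilE`,
`R7a.choose_bridge`, `R7a.permType_of_rankOne_largeCoeff/absent`, `toolBound_mono`, `tab`, `sgn`, `R6b.sum_sgn`, `rW`/`R6b.rW_pos`, `lwt_piT`,
`PlanarCell.eq_of_nsmul_eq`/`wt_sum`, `FormalLogLinearisation.wt_nsmul`, `R8.W`/`R8.card_W_le`, `ShiftRank.pencilCount`,
`BinExpSum.pencilCount_arith`, val-neg-1 g4's `DatumExcess.*`, `RankOneCoverage.eq_of_tsub_eq_zero`, `OneSidedMembership.*`.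
Namespace `…PermutationType.R9`.  Nothing here closes the line's residual (`ResidualLawV20`), the crux `TwoProducts` (5906) or `VP ≠ VNP`;
no summit statement is proved.

Honest scope: coincidence modules of RANK ≥ 2 (val-neg-1 g4's p635223 `RankTwoEscapes`) are NOT covered; after R9 the residual of the line is
«no lattice-small permutation-type contraction (R5), no cheap class cover (R1_r), coincidence rank ≥ 2».  Nothing here moves VP ≠ VNP;
`TwoProducts` (5906) / `PlanarCellBound` stay OPEN. [folklore]

Cut table (scratch `HOME/lmr/staged/p3g16-R9/R9-Scratch.lean`, 2 249 lines, rc 0 / 0 warnings / 0 sorries, axioms standard): part 1 `…Lift` =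
T2 (`GIdx`, `P`/`N`/`rel`/`rest`, `frM` and its coordinates, `Idle`, the table sums `sum_frM_inl/inr`); part 2 `…Fibres` = T3 (`xhat`, `Lrel`,
`Lof`, `Adm`, `sA`, `KR`, `eq_Lof_of_piT`, `piT_Lof`, degrees, `Bk`, `Pfac`, `kap`, `multinomial_Lof_eq`, `coeff_phiT_frM`); part 3 `…Slice` =
T4 slice functions, THE COEFFICIENT THEOREM `coeff_free_logTrunc`, T5 finite shift rank `Fsl_shift`; part 4 `…SliceExc` = the exceptional point,
`mem_support_free_logTrunc_iff`, `Fsl_zero_zero`, `xOf`, `Fsl_congr`; part 5 `…Planar` = T7 `RelDataG`, `D`, `cell`, `enumP`, `piE_enumP_frM`,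
`phi_GT`, `injOn_of_rankOne`, `lifted_of_visible`; part 6 `…Weights` = product-plan weights `θW`, `lwt_θW_frM`, `lwt_splitG`, T8
`sliceMin_of_visible`; part 7 `…Count` = `sliceCount`, `RelDataG.count`, `permType_of_rankOne_wideSide`, `sides_of_shift`, `sum_enum_smul_eq`,
`mapDomain_enum_table`; part 8 `…Law` = arithmetic (`c = 1416`), `rankOneSchemaLaw_proof`.
-/

noncomputable section

-- Sub = Summit single-conjunct layout: the duplicated namespace component is mandated by the tree.
set_option linter.dupNamespace false
set_option linter.unusedSimpArgs false
set_option linter.unusedSectionVars false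
set_option linter.unusedVariables false

namespace Summit.ValiantsHypothesis.ValiantsHypothesis.Theorems.NewtonUnitEquations.TwoProducts.PermutationType
namespace R9
open scoped BigOperators
open MvPolynomial

variable {σ : Type*} [Fintype σ] [DecidableEq σ]

variable (Itr : GIdx σ)
/-! ## Part T3: reduced exponents, fibres with a consistency guard, degrees, the multinomial regrouping -/

/-- The reduced exponent `x̂` on the LETTER box: the free coordinates of the free letters. [folklore] -/
def xhat (x : σ ⊕ σ × σ →₀ ℕ) : σ →₀ ℕ := ofFun fun k => if Itr.pf k = 0 ∧ Itr.qf k = 0 then x (Sum.inl k) else 0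

/-- The reduced exponent at a free letter. [folklore] -/
theorem xhat_rest (x : σ ⊕ σ × σ →₀ ℕ) {k : σ} (hk : k ∈ rest Itr) : xhat Itr x k = x (Sum.inl k) := by
  unfold xhat; rw [ofFun_apply, if_pos ((mem_rest Itr k).1 hk)]

/-- The reduced exponent at a relation letter. [folklore] -/
theorem xhat_rel (x : σ ⊕ σ × σ →₀ ℕ) {k : σ} (hk : k ∈ rel Itr) : xhat Itr x k = 0 := by
  unfold xhat; rw [ofFun_apply, if_neg ((mem_rel Itr k).1 hk)]

/-- The relation part of the fibre element with `#α_{a₀} = κ` over the slice `b` (the atom exponents):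
`#β_j = (b (a₀, j) − qf j κ) / pf a₀`, `#α_i = (b (i, b₀) − pf i #β_{b₀}) / qf b₀`. [folklore] -/
def Lrel (b : σ × σ → ℕ) (κ : ℕ) (k : σ) : ℕ :=
  if k = Itr.a₀ then κ
  else if Itr.qf k ≠ 0 then (b (Itr.a₀, k) - Itr.qf k * κ) / Itr.pf Itr.a₀
  else if Itr.pf k ≠ 0 then (b (k, Itr.b₀) - Itr.pf k * ((b (Itr.a₀, Itr.b₀) - Itr.qf Itr.b₀ * κ) / Itr.pf Itr.a₀)) / Itr.qf Itr.b₀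
  else 0

/-- The relation part at `a₀`. [folklore] -/
theorem Lrel_a₀ (b : σ × σ → ℕ) (κ : ℕ) : Lrel Itr b κ Itr.a₀ = κ := by
  unfold Lrel; rw [if_pos rfl]

/-- The relation part at an `N` letter. [folklore] -/
theorem Lrel_N (b : σ × σ → ℕ) (κ : ℕ) {k : σ} (hk : k ∈ N Itr) :
    Lrel Itr b κ k = (b (Itr.a₀, k) - Itr.qf k * κ) / Itr.pf Itr.a₀ := by
  have hq := (mem_N Itr k).1 hk
  have hka : k ≠ Itr.a₀ := fun h => by rw [h] at hq; exact hq (qf_a₀ Itr)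
  unfold Lrel; rw [if_neg hka, if_pos hq]

/-- The relation part at a `P` letter other than `a₀`. [folklore] -/
theorem Lrel_P (b : σ × σ → ℕ) (κ : ℕ) {k : σ} (hk : k ∈ P Itr) (hka : k ≠ Itr.a₀) :
    Lrel Itr b κ k = (b (k, Itr.b₀) - Itr.pf k * Lrel Itr b κ Itr.b₀) / Itr.qf Itr.b₀ := by
  have hp := (mem_P Itr k).1 hk
  have hq := qf_eq_zero_of_mem_P Itr hk
  rw [Lrel_N Itr b κ (b₀_mem_N Itr)]
  conv_lhs => unfold Lrel
  rw [if_neg hka, if_neg (by simpa using hq), if_pos hp]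

/-- The relation part vanishes at a free letter. [folklore] -/
theorem Lrel_rest (b : σ × σ → ℕ) (κ : ℕ) {k : σ} (hk : k ∈ rest Itr) : Lrel Itr b κ k = 0 := by
  obtain ⟨hp, hq⟩ := (mem_rest Itr k).1 hk
  have hka : k ≠ Itr.a₀ := fun h => Itr.hpa (by rw [← h]; exact hp)
  unfold Lrel; rw [if_neg hka, if_neg (by simpa using hq), if_neg (by simpa using hp)]

/-- The letter multiset in the fibre over `x` with `#α_{a₀} = κ`. [folklore] -/
def Lof (x : σ ⊕ σ × σ →₀ ℕ) (κ : ℕ) : σ →₀ ℕ :=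
  ofFun fun k => if Itr.pf k = 0 ∧ Itr.qf k = 0 then x (Sum.inl k) else Lrel Itr (fun ij => x (Sum.inr ij)) κ k

/-- The fibre element at a free letter. [folklore] -/
theorem Lof_rest (x : σ ⊕ σ × σ →₀ ℕ) (κ : ℕ) {k : σ} (hk : k ∈ rest Itr) : Lof Itr x κ k = x (Sum.inl k) := by
  unfold Lof; rw [ofFun_apply, if_pos ((mem_rest Itr k).1 hk)]

/-- The fibre element at a relation letter. [folklore] -/
theorem Lof_rel (x : σ ⊕ σ × σ →₀ ℕ) (κ : ℕ) {k : σ} (hk : k ∈ rel Itr) :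
    Lof Itr x κ k = Lrel Itr (fun ij => x (Sum.inr ij)) κ k := by
  unfold Lof; rw [ofFun_apply, if_neg ((mem_rel Itr k).1 hk)]

/-- The fibre element at `a₀`. [folklore] -/
theorem Lof_a₀ (x : σ ⊕ σ × σ →₀ ℕ) (κ : ℕ) : Lof Itr x κ Itr.a₀ = κ := by
  rw [Lof_rel Itr x κ (mem_rel_of_mem_P Itr (a₀_mem_P Itr)), Lrel_a₀]

/-- Admissibility of `κ = #α_{a₀}` for the slice `b`: the CONSISTENCY of the relation part with all atom exponents. [folklore] -/
abbrev Adm (b : σ × σ → ℕ) (κ : ℕ) : Prop :=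
  ∀ i ∈ P Itr, ∀ j ∈ N Itr, Itr.qf j * Lrel Itr b κ i + Itr.pf i * Lrel Itr b κ j = b (i, j)

/-- The total atom mass `Σ_{(i,j) ∈ P × N} b (i, j)` of a slice. [folklore] -/
def sA (b : σ × σ → ℕ) : ℕ := ∑ i ∈ P Itr, ∑ j ∈ N Itr, b (i, j)

/-- An admissible `κ` is at most the atom mass. [folklore] -/
theorem le_sA_of_adm {b : σ × σ → ℕ} {κ : ℕ} (hκ : Adm Itr b κ) : κ ≤ sA Itr b := by
  have h := hκ Itr.a₀ (a₀_mem_P Itr) Itr.b₀ (b₀_mem_N Itr)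
  rw [Lrel_a₀] at h
  have h1 : 1 ≤ Itr.qf Itr.b₀ := Nat.one_le_iff_ne_zero.mpr Itr.hqb
  calc κ ≤ Itr.qf Itr.b₀ * κ := Nat.le_mul_of_pos_left κ h1
    _ ≤ b (Itr.a₀, Itr.b₀) := by omega
    _ ≤ ∑ j ∈ N Itr, b (Itr.a₀, j) := Finset.single_le_sum (f := fun j => b (Itr.a₀, j)) (fun j _ => Nat.zero_le _) (b₀_mem_N Itr)
    _ ≤ sA Itr b := Finset.single_le_sum (f := fun i => ∑ j ∈ N Itr, b (i, j)) (fun i _ => Nat.zero_le _) (a₀_mem_P Itr)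

/-- The admissible range of `κ` in the fibre over `x`. [folklore] -/
def KR (x : σ ⊕ σ × σ →₀ ℕ) : Finset ℕ :=
  (Finset.range (sA Itr (fun ij => x (Sum.inr ij)) + 1)).filter fun κ => Adm Itr (fun ij => x (Sum.inr ij)) κ

/-- Membership in the admissible range. [folklore] -/
theorem mem_KR (x : σ ⊕ σ × σ →₀ ℕ) (κ : ℕ) : κ ∈ KR Itr x ↔ Adm Itr (fun ij => x (Sum.inr ij)) κ := by
  unfold KR
  rw [Finset.mem_filter, Finset.mem_range]
  constructor
  · exact fun h => h.2
  · intro h; exact ⟨Nat.lt_succ_of_le (le_sA_of_adm Itr h), h⟩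

/-- (F1) Every preimage of `x` is an `Lof x κ` with `κ` admissible, and `x` is idle-free. [folklore] -/
theorem eq_Lof_of_piT (L : σ →₀ ℕ) (x : σ ⊕ σ × σ →₀ ℕ) (h : piT (frM Itr) L = x) :
    Idle Itr x ∧ L Itr.a₀ ∈ KR Itr x ∧ L = Lof Itr x (L Itr.a₀) := by
  have hidle : Idle Itr x := by rw [← h]; exact idle_piT Itr L
  have hA : ∀ i ∈ P Itr, ∀ j ∈ N Itr, x (Sum.inr (i, j)) = Itr.qf j * L i + Itr.pf i * L j := fun i hi j hj => by
    rw [← h, piT_frM_atom Itr L hi hj]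
  have hpa : 1 ≤ Itr.pf Itr.a₀ := Nat.one_le_iff_ne_zero.mpr Itr.hpa
  have hqb : 1 ≤ Itr.qf Itr.b₀ := Nat.one_le_iff_ne_zero.mpr Itr.hqb
  -- the relation part reproduces `L` on the relation letters
  have hN : ∀ k ∈ N Itr, Lrel Itr (fun ij => x (Sum.inr ij)) (L Itr.a₀) k = L k := fun k hk => by
    rw [Lrel_N Itr _ _ hk]
    rw [hA Itr.a₀ (a₀_mem_P Itr) k hk, show Itr.qf k * L Itr.a₀ + Itr.pf Itr.a₀ * L k - Itr.qf k * L Itr.a₀ = Itr.pf Itr.a₀ * L k by omega,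
      Nat.mul_div_cancel_left _ hpa]
  have hP : ∀ k ∈ P Itr, Lrel Itr (fun ij => x (Sum.inr ij)) (L Itr.a₀) k = L k := fun k hk => by
    by_cases hka : k = Itr.a₀
    · rw [hka, Lrel_a₀]
    · rw [Lrel_P Itr _ _ hk hka, hN Itr.b₀ (b₀_mem_N Itr)]
      rw [hA k hk Itr.b₀ (b₀_mem_N Itr), show Itr.qf Itr.b₀ * L k + Itr.pf k * L Itr.b₀ - Itr.pf k * L Itr.b₀ = Itr.qf Itr.b₀ * L k by omega,
        Nat.mul_div_cancel_left _ hqb]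
  have hrel : ∀ k ∈ rel Itr, Lrel Itr (fun ij => x (Sum.inr ij)) (L Itr.a₀) k = L k := fun k hk => by
    rw [rel_eq_union, Finset.mem_union] at hk
    rcases hk with hk | hk
    · exact hP k hk
    · exact hN k hk
  have hadm : Adm Itr (fun ij => x (Sum.inr ij)) (L Itr.a₀) := fun i hi j hj => by
    beta_reduce
    rw [hP i hi, hN j hj, hA i hi j hj]
  refine ⟨hidle, (mem_KR Itr x _).2 hadm, ?_⟩
  ext k
  by_cases hk : Itr.pf k = 0 ∧ Itr.qf k = 0
  · have hkr : k ∈ rest Itr := (mem_rest Itr k).2 hk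
    rw [Lof_rest Itr x _ hkr, ← h, piT_frM_rest Itr L hkr]
  · have hkr : k ∈ rel Itr := (mem_rel Itr k).2 hk
    rw [Lof_rel Itr x _ hkr, hrel k hkr]

/-- (F2) Every admissible `Lof x κ` lies in the fibre over an idle-free `x`. [folklore] -/
theorem piT_Lof (x : σ ⊕ σ × σ →₀ ℕ) (hx : Idle Itr x) (κ : ℕ) (hκ : κ ∈ KR Itr x) : piT (frM Itr) (Lof Itr x κ) = x := by
  rw [mem_KR] at hκ
  ext t
  rcases t with k | ⟨i, j⟩
  · rw [piT_frM_inl]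
    by_cases hk : Itr.pf k = 0 ∧ Itr.qf k = 0
    · rw [if_pos hk, Lof_rest Itr x κ ((mem_rest Itr k).2 hk)]
    · rw [if_neg hk, hx.1 k hk]
  · rw [piT_frM_inr]
    by_cases hij : Itr.pf i ≠ 0 ∧ Itr.qf j ≠ 0
    · have hi : i ∈ P Itr := (mem_P Itr i).2 hij.1
      have hj : j ∈ N Itr := (mem_N Itr j).2 hij.2
      rw [if_pos hij, Lof_rel Itr x κ (mem_rel_of_mem_P Itr hi), Lof_rel Itr x κ (mem_rel_of_mem_N Itr hj), hκ i hi j hj]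
    · rw [if_neg hij, hx.2 i j hij]

/-- The degree of the reduced exponent: `R = Σ_{free} x (inl k)`. [folklore] -/
theorem deg_xhat (x : σ ⊕ σ × σ →₀ ℕ) : deg (xhat Itr x) = ∑ k ∈ rest Itr, x (Sum.inl k) := by
  rw [deg_eq_sum, sum_split Itr, Finset.sum_eq_zero (fun k hk => xhat_rel Itr x hk), add_zero]
  exact Finset.sum_congr rfl fun k hk => xhat_rest Itr x hk

/-- The atom mass of an upstairs exponent is the sum over ALL atom coordinates when the exponent is idle-free. [folklore] -/
theorem sum_inr_eq_sA (x : σ ⊕ σ × σ →₀ ℕ) (hx : Idle Itr x) :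
    ∑ ij : σ × σ, x (Sum.inr ij) = sA Itr (fun ij => x (Sum.inr ij)) := by
  unfold sA
  rw [← Finset.sum_product (s := P Itr) (t := N Itr) (f := fun ij => x (Sum.inr ij))]
  symm
  refine Finset.sum_subset (Finset.subset_univ _) fun ij _ hij => ?_
  rcases ij with ⟨i, j⟩
  rw [Finset.mem_product, mem_P, mem_N] at hij
  exact hx.2 i j hij

/-- The full degree in terms of the reduced one (idle-free exponents). [folklore] -/
theorem deg_eq_deg_xhat_add (x : σ ⊕ σ × σ →₀ ℕ) (hx : Idle Itr x) :
    deg x = deg (xhat Itr x) + sA Itr (fun ij => x (Sum.inr ij)) := by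
  rw [deg_xhat, deg_eq_sum, Fintype.sum_sum_type, sum_inr_eq_sA Itr x hx]
  congr 1
  unfold rest
  rw [Finset.sum_filter]
  refine Finset.sum_congr rfl fun k _ => ?_
  by_cases hk : Itr.pf k = 0 ∧ Itr.qf k = 0
  · rw [if_pos hk]
  · rw [if_neg hk, hx.1 k hk]

/-- The relation mass `B_κ = Σ_{rel} Lrel b κ k` of the fibre element. [folklore] -/
def Bk (b : σ × σ → ℕ) (κ : ℕ) : ℕ := ∑ k ∈ rel Itr, Lrel Itr b κ k

/-- (F4) The degree along the fibre: `deg (Lof x κ) = R + B_κ`. [folklore] -/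
theorem deg_Lof_eq (x : σ ⊕ σ × σ →₀ ℕ) (κ : ℕ) :
    deg (Lof Itr x κ) = deg (xhat Itr x) + Bk Itr (fun ij => x (Sum.inr ij)) κ := by
  rw [deg_xhat, deg_eq_sum, sum_split Itr]
  unfold Bk
  rw [Finset.sum_congr rfl fun k hk => Lof_rest Itr x κ hk, Finset.sum_congr rfl fun k hk => Lof_rel Itr x κ hk]

/-- `B_κ ≤ Σ_A b` for admissible `κ`. [folklore] -/
theorem Bk_le {b : σ × σ → ℕ} {κ : ℕ} (hκ : Adm Itr b κ) : Bk Itr b κ ≤ sA Itr b := by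
  have hqb : 1 ≤ Itr.qf Itr.b₀ := Nat.one_le_iff_ne_zero.mpr Itr.hqb
  have hpa : 1 ≤ Itr.pf Itr.a₀ := Nat.one_le_iff_ne_zero.mpr Itr.hpa
  have hP : ∀ i ∈ P Itr, Lrel Itr b κ i ≤ ∑ j ∈ N Itr, Itr.qf j * Lrel Itr b κ i := fun i hi =>
    calc Lrel Itr b κ i ≤ Itr.qf Itr.b₀ * Lrel Itr b κ i := Nat.le_mul_of_pos_left _ hqb
      _ ≤ ∑ j ∈ N Itr, Itr.qf j * Lrel Itr b κ i :=
          Finset.single_le_sum (f := fun j => Itr.qf j * Lrel Itr b κ i) (fun j _ => Nat.zero_le _) (b₀_mem_N Itr)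
  have hN : ∀ j ∈ N Itr, Lrel Itr b κ j ≤ ∑ i ∈ P Itr, Itr.pf i * Lrel Itr b κ j := fun j hj =>
    calc Lrel Itr b κ j ≤ Itr.pf Itr.a₀ * Lrel Itr b κ j := Nat.le_mul_of_pos_left _ hpa
      _ ≤ ∑ i ∈ P Itr, Itr.pf i * Lrel Itr b κ j :=
          Finset.single_le_sum (f := fun i => Itr.pf i * Lrel Itr b κ j) (fun i _ => Nat.zero_le _) (a₀_mem_P Itr)
  have hsA : sA Itr b = (∑ i ∈ P Itr, ∑ j ∈ N Itr, Itr.qf j * Lrel Itr b κ i) + ∑ j ∈ N Itr, ∑ i ∈ P Itr, Itr.pf i * Lrel Itr b κ j := by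
    unfold sA
    rw [Finset.sum_comm (s := N Itr) (t := P Itr), ← Finset.sum_add_distrib]
    refine Finset.sum_congr rfl fun i hi => ?_
    rw [← Finset.sum_add_distrib]
    exact Finset.sum_congr rfl fun j hj => (hκ i hi j hj).symm
  unfold Bk
  rw [sum_rel Itr, hsA]
  exact Nat.add_le_add (Finset.sum_le_sum hP) (Finset.sum_le_sum hN)

/-- `1 ≤ B_κ` for admissible `κ` on a slice of positive atom mass. [folklore] -/
theorem Bk_pos {b : σ × σ → ℕ} {κ : ℕ} (hκ : Adm Itr b κ) (hb : 1 ≤ sA Itr b) : 1 ≤ Bk Itr b κ := by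
  by_contra h0
  have hB : Bk Itr b κ = 0 := by omega
  unfold Bk at hB
  have hz : ∀ k ∈ rel Itr, Lrel Itr b κ k = 0 := fun k hk => (Finset.sum_eq_zero_iff.mp hB) k hk
  have hzero : ∀ i ∈ P Itr, ∀ j ∈ N Itr, b (i, j) = 0 := fun i hi j hj => by
    rw [← hκ i hi j hj, hz i (mem_rel_of_mem_P Itr hi), hz j (mem_rel_of_mem_N Itr hj)]; simp
  have : sA Itr b = 0 := Finset.sum_eq_zero fun i hi => Finset.sum_eq_zero fun j hj => hzero i hi j hj
  omega

/-- The slice normaliser `(R - 1)! / ∏_{free} x_k!` (nonzero). [folklore] -/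
def Pfac (x : σ ⊕ σ × σ →₀ ℕ) : ℂ :=
  (((deg (xhat Itr x) - 1).factorial : ℕ) : ℂ) / (((∏ k ∈ rest Itr, (x (Sum.inl k)).factorial : ℕ)) : ℂ)

/-- The slice normaliser is nonzero. [folklore] -/
theorem Pfac_ne_zero (x : σ ⊕ σ × σ →₀ ℕ) : Pfac Itr x ≠ 0 := by
  unfold Pfac
  refine div_ne_zero (Nat.cast_ne_zero.mpr (Nat.factorial_ne_zero _)) (Nat.cast_ne_zero.mpr ?_)
  exact Finset.prod_ne_zero_iff.mpr fun k _ => Nat.factorial_ne_zero _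

/-- The fibre constant `κ_κ = B_κ! / ∏_{rel} (Lrel b κ k)!`. [folklore] -/
def kap (b : σ × σ → ℕ) (κ : ℕ) : ℂ :=
  (((Bk Itr b κ).factorial : ℕ) : ℂ) / (((∏ k ∈ rel Itr, (Lrel Itr b κ k).factorial : ℕ)) : ℂ)

/-- (F5) **Multinomial regrouping along the fibre**:
`multinomial(L_κ) = Pfac(x) · C(R + B_κ − 1, B_κ) · κ_κ · deg(L_κ)` for `R = deg x̂ ≥ 1`. [folklore] -/
theorem multinomial_Lof_eq (x : σ ⊕ σ × σ →₀ ℕ) (κ : ℕ) (h1 : 1 ≤ deg (xhat Itr x)) :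
    ((Lof Itr x κ).multinomial : ℂ) =
      Pfac Itr x * (((deg (xhat Itr x) + Bk Itr (fun ij => x (Sum.inr ij)) κ - 1).choose
        (Bk Itr (fun ij => x (Sum.inr ij)) κ) : ℕ) : ℂ) *
        kap Itr (fun ij => x (Sum.inr ij)) κ * ((deg (Lof Itr x κ) : ℕ) : ℂ) := by
  have hdeg := deg_Lof_eq Itr x κ
  set b : σ × σ → ℕ := fun ij => x (Sum.inr ij) with hb
  set D := deg (xhat Itr x) with hD
  set Bq := Bk Itr b κ with hB
  set n := deg (Lof Itr x κ) with hn
  have sL := Nat.multinomial_spec (Finset.univ : Finset σ) (Lof Itr x κ)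
  rw [← multinomial_univ, ← deg_eq_sum] at sL
  rw [prod_split Itr] at sL
  have hr : ∏ k ∈ rest Itr, ((Lof Itr x κ) k).factorial = ∏ k ∈ rest Itr, (x (Sum.inl k)).factorial :=
    Finset.prod_congr rfl fun k hk => by rw [Lof_rest Itr x κ hk]
  have hrl : ∏ k ∈ rel Itr, ((Lof Itr x κ) k).factorial = ∏ k ∈ rel Itr, (Lrel Itr b κ k).factorial :=
    Finset.prod_congr rfl fun k hk => by rw [Lof_rel Itr x κ hk]
  rw [hr, hrl, ← hn] at sL
  have h2 : (D + Bq - 1).choose Bq * Bq.factorial * (D - 1).factorial = (D + Bq - 1).factorial := by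
    have := Nat.choose_mul_factorial_mul_factorial (n := D + Bq - 1) (k := Bq) (by omega)
    rwa [show D + Bq - 1 - Bq = D - 1 by omega] at this
  have h3 : n.factorial = n * (D + Bq - 1).factorial := by
    rw [show n = (D + Bq - 1) + 1 by omega, Nat.factorial_succ]
  set Pr : ℂ := ∏ k ∈ rest Itr, ((((x (Sum.inl k)).factorial : ℕ)) : ℂ) with hPr
  set Kd : ℂ := ∏ k ∈ rel Itr, ((((Lrel Itr b κ k).factorial : ℕ)) : ℂ) with hKd
  have hPne : Pr ≠ 0 := Finset.prod_ne_zero_iff.mpr fun k _ => Nat.cast_ne_zero.mpr (Nat.factorial_ne_zero _)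
  have hKdne : Kd ≠ 0 := Finset.prod_ne_zero_iff.mpr fun k _ => Nat.cast_ne_zero.mpr (Nat.factorial_ne_zero _)
  have key : ((Lof Itr x κ).multinomial : ℂ) * (Pr * Kd) =
      (n : ℂ) * ((((D + Bq - 1).choose Bq : ℕ) : ℂ) * ((Bq.factorial : ℕ) : ℂ) * (((D - 1).factorial : ℕ) : ℂ)) := by
    have e : ((((∏ k ∈ rest Itr, (x (Sum.inl k)).factorial) * (∏ k ∈ rel Itr, (Lrel Itr b κ k).factorial) *
        (Lof Itr x κ).multinomial : ℕ)) : ℂ) = ((n.factorial : ℕ) : ℂ) := by exact_mod_cast sL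
    rw [h3, ← h2] at e
    push_cast at e
    rw [hPr, hKd]
    linear_combination e
  have hPf : Pfac Itr x = (((D - 1).factorial : ℕ) : ℂ) / Pr := by
    unfold Pfac; rw [hPr]; push_cast; rfl
  have hkap : kap Itr b κ = ((Bq.factorial : ℕ) : ℂ) / Kd := by
    unfold kap; rw [hKd, hB]; push_cast; rfl
  rw [hPf, hkap]
  calc ((Lof Itr x κ).multinomial : ℂ) = ((Lof Itr x κ).multinomial : ℂ) * (Pr * Kd) / (Pr * Kd) := by
        field_simp
    _ = (n : ℂ) * ((((D + Bq - 1).choose Bq : ℕ) : ℂ) * ((Bq.factorial : ℕ) : ℂ) * (((D - 1).factorial : ℕ) : ℂ)) /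
          (Pr * Kd) := by rw [key]
    _ = (((D - 1).factorial : ℕ) : ℂ) / Pr * ((((D + Bq - 1).choose Bq : ℕ)) : ℂ) *
          (((Bq.factorial : ℕ) : ℂ) / Kd) * (n : ℂ) := by
        field_simp

/-- Fibre sums of the substitution: `coeff_x (φ_frM H) = Σ_{κ ∈ KR x} coeff_{L_κ} H` (idle-free `x`). [folklore] -/
theorem coeff_phiT_frM (H : MvPolynomial σ ℂ) (x : σ ⊕ σ × σ →₀ ℕ) (hx : Idle Itr x) :
    coeff x (phiT (frM Itr) H) = ∑ κ ∈ KR Itr x, coeff (Lof Itr x κ) H := by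
  classical
  rw [coeff_phiT]
  rw [← Finset.sum_filter_add_sum_filter_not (KR Itr x) (fun κ => Lof Itr x κ ∈ H.support)]
  rw [Finset.sum_eq_zero (s := (KR Itr x).filter fun κ => ¬ Lof Itr x κ ∈ H.support)
    (fun κ hκ => notMem_support_iff.mp (Finset.mem_filter.mp hκ).2), add_zero]
  apply Finset.sum_nbij' (fun L => L Itr.a₀) (fun κ => Lof Itr x κ)
  · intro L hL
    rw [Finset.mem_filter] at hL
    obtain ⟨-, hκ, hLeq⟩ := eq_Lof_of_piT Itr L x hL.2
    rw [Finset.mem_filter, ← hLeq]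
    exact ⟨hκ, hL.1⟩
  · intro κ hκ
    rw [Finset.mem_filter] at hκ
    rw [Finset.mem_filter]
    exact ⟨hκ.2, piT_Lof Itr x hx κ hκ.1⟩
  · intro L hL
    rw [Finset.mem_filter] at hL
    exact (eq_Lof_of_piT Itr L x hL.2).2.2.symm
  · intro κ _
    exact Lof_a₀ Itr x κ
  · intro L hL
    rw [Finset.mem_filter] at hL
    obtain ⟨-, -, hLeq⟩ := eq_Lof_of_piT Itr L x hL.2
    rw [← hLeq]

end R9
end Summit.ValiantsHypothesis.ValiantsHypothesis.Theorems.NewtonUnitEquations.TwoProducts.PermutationType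

end
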